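import Literature.NumberTheory.Automorphic.RankinSelbergTwistedUnfoldingFibre
import Literature.MeasureTheory.Group.InvariantQuotientUnfoldingBochner
import HarnessLib

/-!
# Unfolding the automorphic quotient against an idele-class Eisenstein integral twisted by a
# character: `∫_X E^η_X(x) F(x) dμ = C ∫_{GL_n(𝔸_K)} W(g) β(g) F(π g⁻¹) dν(g)` for `F` with central
# character `η⁻¹`

Topic `NumberTheory/Automorphic`; namespace `Literature.NumberTheory.Automorphic`. Proof file
(theorems only). The **twisted** companion of `RankinSelbergQuotientUnfolding`
(`exists_lintegral_eisensteinLIntegral_mul_eq`: Jacquet–Shalika (1981), §4, (4.2)–(4.4); Cogdell (2004),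
§2.3, the first unfolding of `I(s; φ, φ', Φ) = ∫ φ φ' E(g, Φ; s, η)`), a brick of the inline decomposition of
the named fact `MoeglinWaldspurger1989_partialPairL_entire_of_ne_conj` (Mœglin–Waldspurger (1989),
Appendice, Cor. (i)(b)) for the pairs of cuspidal representations whose central characters do not cancel,
treated in print with the mirabolic Eisenstein series twisted by `η = ω_π ω_{π'}`
(`MirabolicEisensteinSeriesTwisted`; Cogdell (2004), §2.3, p. 211: under the centre the series
transforms by `η⁻¹`, so that `φ φ' E(·; s, η)` is a function on `Z(𝔸) GL_n(k) \ GL_n(𝔸)`).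

Everything is in Bochner form and for a general complex weight: let `W : GL_n(𝔸_K) → ℂ` be Borel and
left invariant under `GL_n(K)` (in the application the theta weight `W_s(g) = |det g|^s Σ_{v ≠ 0} Φ(v g)`),
`η` a unitary Hecke character trivial on `A_G`, `𝓕 ⊆ 𝔸_Kˣ` an idele class domain, and

  `E^η_W(y) = ∫_𝓕 W(a · y) η(a) dν_I(a)`  (`a · y = (a 1_n) y`)

its twisted idele-class Eisenstein integral (for `W = W_s` and `re s > 1` this is the twisted mirabolic
Eisenstein series `E(y, Φ; s, η)`, `mirabolicEisensteinTwisted_one_eq_setIntegral_thetaStar`). Then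
(`exists_integral_eisensteinTwisted_mul_eq`, **main**): there is `C > 0` depending only on the measures
such that for every Borel `F` on `X = GL_n(𝔸_K) ⧸ A_G GL_n(K)` **with central character `η⁻¹`**
(`F(π(a · y)) = η(a)⁻¹ F(π y)`; e.g. `F = φ φ̄'` with `ω_π ω̄_σ = η⁻¹`), every Borel `E_X` on `X` with
`E_X(π g) = E^η_W(g⁻¹)`, and every `GL_n(K)`-covering weight `β`, under the two absolute-convergence
hypotheses of the theory (the majorant `∫_𝓕 |W(a · g⁻¹)| dν_I` is finite for every `g`, and
`∫ |W(g) F(π g⁻¹)| β(g) dν < ∞`),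

  `∫_X E_X(x) F(x) dμ(x) = C ∫_{GL_n(𝔸_K)} W(g) β(g) F(π g⁻¹) dν(g)`.

Proof: Weil's formula for `H = A_G GL_n(K)` in Bochner form (`integral_fiberIntegralE_mul_eq`,
`InvariantQuotientUnfoldingBochner`) applied to the twisted test function
`f_η(y) = (∫_{𝕀_K¹} W(b · y⁻¹) η(b) β¹(b) dβ) β(y⁻¹)`: its fibre integral is `κ κ₁⁻¹ E^η_W(g⁻¹)`
(`integral_quotientSubgroup_testFunTwisted_eq`, `RankinSelbergTwistedUnfoldingFibre`), and on the group
side the `𝕀_K¹`-average against `η` meets the central character `η⁻¹` of `F` and leaves `∫ β¹ dβ`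
(`integral_testFunTwisted_mul_eq`, `RankinSelbergTwistedUnfoldingGroupSide`); the integrability of
`f_η · F∘π` is the untwisted `[0, ∞]` identity `lintegral_testFun_mul_eq` for `|W|`, `|F|`.

## References

* H. Jacquet, J. A. Shalika, *On Euler products and the classification of automorphic
  representations I*, Amer. J. Math. 103 (1981), §4 [JacquetShalikaAJM1981].
* J. W. Cogdell, *Analytic theory of L-functions for GL_n*, in *An Introduction to the Langlands
  Program* (2004), §2.3 (PDF pp. 186–188 of the held copy) [CogdellAnalyticTheory2004].
* J. R. Getz, H. Hahn, *An Introduction to Automorphic Representations* (2024), Thm. 3.2.2, Lemma 9.2.4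
  [GetzHahn2024].
-/

noncomputable section

open MeasureTheory Measure Set Filter Topology IsDedekindDomain NumberField Function
open Literature.MeasureTheory.Group
open scoped ENNReal NNReal Pointwise

namespace Literature.NumberTheory.Automorphic

open Literature.NumberTheory.GaloisRepresentations (ideleGroup principalIdeles HeckeCharacter)

-- the quotient carries the tree's Borel σ-algebra, not Mathlib's quotient σ-algebra
attribute [-instance] Quotient.instMeasurableSpace QuotientGroup.measurableSpace

section Unfolding

variable {n : ℕ} {K : Type} [Field K] [NumberField K]

attribute [local instance] adelicBorel borelSpace_adelic locallyCompactSpace_adelic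
  secondCountableTopology_gl_adelic glAdeleBorel borelSpace_glAdele
  measurableSpaceQuotient borelSpaceQuotient smulInvariantMeasureQuotient isFiniteMeasureOnCompactsQuotient

variable [MeasurableSpace (ideleGroup K)] [BorelSpace (ideleGroup K)]

/-- **The first unfolding of the twisted Rankin–Selberg integral, for a general weight (Bochner form).**
Let `0 < n`, `μ` an automorphic measure on `X = GL_n(𝔸_K) ⧸ A_G GL_n(K)`, `ν` a Haar measure on
`GL_n(𝔸_K)` and `ν_I` a Haar measure on `𝔸_Kˣ`. There is `C > 0`, depending only on these measures, such
that for every idele class domain `𝓕`, every unitary Hecke character `η` trivial on `A_G`, every Borel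
`W : GL_n(𝔸_K) → ℂ` left invariant under `GL_n(K)` whose majorant idele-class integrals
`∫_𝓕 |W((a 1_n) g⁻¹)| dν_I` are finite, every Borel `F` on `X` with central character `η⁻¹`
(`F(π((z 1_n) y)) = η(z)⁻¹ F(π y)`), every Borel `E_X` on `X` with
`E_X(π g) = ∫_𝓕 W((a 1_n) g⁻¹) η(a) dν_I(a)` (the twisted idele-class Eisenstein integral `E^η_W(g⁻¹)`) and
every `GL_n(K)`-covering weight `β` with `∫ |W(g) F(π g⁻¹)| β(g) dν < ∞`,

  `∫_X E_X(x) F(x) dμ(x) = C ∫_{GL_n(𝔸_K)} W(g) β(g) F(π g⁻¹) dν(g)`.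

This is the unfolding `∫_{Z GL_n(k)\GL_n(𝔸)} φ φ' E(g,Φ;s,η) dg = ∫_{GL_n(k)\GL_n(𝔸)} φ φ' E_w(g) dg`
(Jacquet–Shalika (1981), §4; Cogdell (2004), §2.3) on the tree's quotient by `A_G GL_n(K)`, whose fibres
over `Z(𝔸) GL_n(k) \ GL_n(𝔸)` are the compact `𝕀_K¹/Kˣ` along which `η` integrates against the central
character `η⁻¹` of `φ φ'` (the volume factor inside `C`). [cite: JacquetShalikaAJM1981, §4]
[cite: CogdellAnalyticTheory2004, §2.3, p. 211] -/
theorem exists_integral_eisensteinTwisted_mul_eq (hn : 0 < n)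
    (μ : Measure (AdelicGroupData.gl n K).automorphicQuotient) [(AdelicGroupData.gl n K).IsAutomorphicMeasure μ]
    (ν : Measure (AdelicGroupData.gl n K).Adelic) [ν.IsHaarMeasure]
    (νI : Measure (ideleGroup K)) [νI.IsHaarMeasure] :
    ∃ C : ℝ, 0 < C ∧
      ∀ {𝓕 : Set (ideleGroup K)}, IsIdeleClassDomain K 𝓕 →
      ∀ {η : HeckeCharacter K}, η.IsUnitary → (∀ t : ℝ≥0ˣ, η (posRealIdele K t) = 1) →
      ∀ {W : GL (Fin n) (AdeleRing (𝓞 K) K) → ℂ}, Measurable W →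
        (∀ (γ : GL (Fin n) K) (g : GL (Fin n) (AdeleRing (𝓞 K) K)),
          W (Matrix.GeneralLinearGroup.map (algebraMap K (AdeleRing (𝓞 K) K)) γ * g) = W g) →
        (∀ g : GL (Fin n) (AdeleRing (𝓞 K) K),
          ∫⁻ a in 𝓕, ‖W (Matrix.GeneralLinearGroup.scalar (Fin n) a * g⁻¹)‖ₑ ∂νI < ⊤) →
      ∀ {F : (AdelicGroupData.gl n K).automorphicQuotient → ℂ}, Measurable F →
        (∀ (z : ideleGroup K) (g : GL (Fin n) (AdeleRing (𝓞 K) K)),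
          F ((AdelicGroupData.gl n K).toAutomorphicQuotient (Matrix.GeneralLinearGroup.scalar (Fin n) z * g)) =
            ((η z : ℂˣ) : ℂ)⁻¹ * F ((AdelicGroupData.gl n K).toAutomorphicQuotient g)) →
      ∀ {EX : (AdelicGroupData.gl n K).automorphicQuotient → ℂ}, Measurable EX →
        (∀ g : GL (Fin n) (AdeleRing (𝓞 K) K), EX ((AdelicGroupData.gl n K).toAutomorphicQuotient g) =
          ∫ a in 𝓕, W (Matrix.GeneralLinearGroup.scalar (Fin n) a * g⁻¹) * ((η a : ℂˣ) : ℂ) ∂νI) →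
      ∀ {βG : GL (Fin n) (AdeleRing (𝓞 K) K) → ℝ≥0∞}, Measurable βG →
        (∀ g, coveringSum ↥(ratPoints (⊤ : Subgroup (GL (Fin n) K))) βG g = 1) →
        ∫⁻ g, ‖W g * F ((AdelicGroupData.gl n K).toAutomorphicQuotient g⁻¹)‖ₑ * βG g ∂ν < ⊤ →
        ∫ x, EX x * F x ∂μ =
          (C : ℂ) * ∫ g, W g * (wt βG g : ℂ) * F ((AdelicGroupData.gl n K).toAutomorphicQuotient g⁻¹) ∂ν := by
  classical
  haveI := secondCountableTopology_ideleGroup K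
  haveI := t2Space_ideleGroup K
  haveI := locallyCompactSpace_ideleGroup K
  haveI := locallyCompactSpace_normOneIdeles K
  haveI := locallyCompactSpace_posRealIdeles K
  haveI : BorelSpace ↥(normOneIdeles K) := Subtype.borelSpace _
  haveI : BorelSpace ↥(posRealIdeles K) := Subtype.borelSpace _
  haveI : SecondCountableTopology ↥(normOneIdeles K) := TopologicalSpace.Subtype.secondCountableTopology _
  haveI : SecondCountableTopology ↥(posRealIdeles K) := TopologicalSpace.Subtype.secondCountableTopology _
  haveI : BorelSpace ↥(AdelicGroupData.gl n K).center' := Subtype.borelSpace _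
  haveI : BorelSpace ↥(AdelicGroupData.gl n K).arithmeticSubgroup := Subtype.borelSpace _
  haveI : BorelSpace ↥(AdelicGroupData.gl n K).quotientSubgroup := Subtype.borelSpace _
  -- unimodularity of `GL_n(𝔸_K)`
  haveI : ν.IsMulRightInvariant := GLn.isMulRightInvariant_of_isHaarMeasure_adelic_holds n K ν inferInstance
  haveI : ν.IsInvInvariant := isInvInvariant_of_isMulRightInvariant ν
  -- auxiliary Haar measures on `𝕀_K¹`, `ρ(ℝ_{>0})` and `A_G`
  set β : Measure ↥(normOneIdeles K) := Measure.haar with hβ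
  set α : Measure ↥(posRealIdeles K) := Measure.haar with hα
  haveI : α.IsInvInvariant := inferInstance
  obtain ⟨ec, hec⟩ := exists_continuousMulEquiv_posRealIdeles_center' n K hn
  set αA : Measure ↥(AdelicGroupData.gl n K).center' := Measure.map ec α with hαA
  haveI : αA.IsHaarMeasure := ec.toMulEquiv.isHaarMeasure_map α ec.continuous ec.symm.continuous
  -- the three constants: idele splitting, fibre product structure, unfolding; and the weight on `𝕀_K¹`
  obtain ⟨κ₁, hκ₁, hsplit⟩ := exists_map_ideleSplitEquiv_eq_smul_prod K νI β α
  obtain ⟨κ, hκ, hfib⟩ := exists_map_quotientSubgroupEquiv_eq_smul_prod (quotientSubgroupHaar n K) αA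
  obtain ⟨β₁, hβ₁, hV0, hVtop⟩ := exists_isCoveringWeight_normOne K β
  set V : ℝ≥0∞ := ∫⁻ b, β₁ b ∂β with hV
  have hVfin : ∫⁻ b, β₁ b ∂β < ⊤ := lt_top_iff_ne_top.2 hVtop
  set c : ℝ≥0 := automorphicUnfoldingConstant n K μ ν with hc
  have hc0 : 0 < c := automorphicUnfoldingConstant_pos n K μ ν
  have hVr0 : 0 < V.toReal := ENNReal.toReal_pos hV0 hVtop
  refine ⟨(c : ℝ) * ((κ : ℝ)⁻¹ * κ₁) * V.toReal,
    mul_pos (mul_pos (NNReal.coe_pos.2 hc0) (mul_pos (inv_pos.2 (NNReal.coe_pos.2 hκ)) (NNReal.coe_pos.2 hκ₁))) hVr0, ?_⟩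
  intro 𝓕 h𝓕 η hηu hη₀ W₀ hW hWK₀ hmaj₀ F hF hFZ₀ EX hEX hEXg₀ βG hβG hβGsum hint
  ----------------------------------------------------------------
  -- the data in the spelling `(AdelicGroupData.gl n K).Adelic` and the scalar embedding
  ----------------------------------------------------------------
  set sc : ideleGroup K →* (AdelicGroupData.gl n K).Adelic := Matrix.GeneralLinearGroup.scalar (Fin n) with hsc
  have hsc_cont : Continuous sc := continuous_generalLinearGroup_scalar_adele n K
  have hsc_comm : ∀ (a : ideleGroup K) (g : (AdelicGroupData.gl n K).Adelic), sc a * g = g * sc a := fun a g =>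
    Matrix.GeneralLinearGroup.scalar_commute a g
  have hscK : ∀ k : ideleGroup K, k ∈ principalIdeles K →
      ∃ γ : GL (Fin n) K, (AdelicGroupData.gl n K).toAdelic γ = sc k := by
    intro k hk
    obtain ⟨γ, hγ⟩ := exists_map_eq_scalar_of_mem_principalIdeles (n := n) hk
    exact ⟨γ, hγ⟩
  set W : (AdelicGroupData.gl n K).Adelic → ℂ := fun y => W₀ y with hWdef
  replace hW : Measurable W := hW
  have hWK : ∀ (γ : GL (Fin n) K) (y : (AdelicGroupData.gl n K).Adelic),
      W ((AdelicGroupData.gl n K).toAdelic γ * y) = W y := fun γ y => hWK₀ γ y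
  have hmaj : ∀ g : (AdelicGroupData.gl n K).Adelic, ∫⁻ a in 𝓕, ‖W (sc a * g⁻¹)‖ₑ ∂νI < ⊤ := fun g => hmaj₀ g
  have hFZ : ∀ (z : ideleGroup K) (g : (AdelicGroupData.gl n K).Adelic),
      F ((AdelicGroupData.gl n K).toAutomorphicQuotient (sc z * g)) =
        ((η z : ℂˣ) : ℂ)⁻¹ * F ((AdelicGroupData.gl n K).toAutomorphicQuotient g) := fun z g => hFZ₀ z g
  have hEXg : ∀ g : (AdelicGroupData.gl n K).Adelic, EX ((AdelicGroupData.gl n K).toAutomorphicQuotient g) =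
      ∫ a in 𝓕, W (sc a * g⁻¹) * ((η a : ℂˣ) : ℂ) ∂νI := fun g => hEXg₀ g
  set βA : (AdelicGroupData.gl n K).Adelic → ℝ≥0∞ := fun y => βG y with hβAdef
  have hβAsum : ∀ y : (AdelicGroupData.gl n K).Adelic,
      coveringSum ↥(AdelicGroupData.gl n K).arithmeticSubgroup βA y = 1 := by
    intro y
    have h := hβGsum y
    rw [ratPoints_top_eq_arithmeticSubgroup] at h
    exact h
  have hβA : IsCoveringWeight ↥(AdelicGroupData.gl n K).arithmeticSubgroup βA := ⟨hβG, hβAsum⟩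
  change ∫ x, EX x * F x ∂μ = _ * ∫ g, W g * (wt βA g : ℂ) * F ((AdelicGroupData.gl n K).toAutomorphicQuotient g⁻¹) ∂ν
  replace hint : ∫⁻ g, ‖W g * F ((AdelicGroupData.gl n K).toAutomorphicQuotient g⁻¹)‖ₑ * βA g ∂ν < ⊤ := hint
  -- the central character of `F` as a unitary Hecke character `ξ = η⁻¹`
  have hξu : (η⁻¹).IsUnitary := fun a => by
    rw [HeckeCharacter.inv_apply, Units.val_inv_eq_inv_val, norm_inv, hηu a, inv_one]
  have hFZ' : ∀ (z : ideleGroup K) (y : (AdelicGroupData.gl n K).Adelic),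
      F ((AdelicGroupData.gl n K).toAutomorphicQuotient (sc z * y)) =
        (((η⁻¹) z : ℂˣ) : ℂ) * F ((AdelicGroupData.gl n K).toAutomorphicQuotient y) := by
    intro z y
    rw [HeckeCharacter.inv_apply, Units.val_inv_eq_inv_val]
    exact hFZ z y
  have hηc : Continuous fun x : ideleGroup K => ((η x : ℂˣ) : ℂ) := Units.continuous_val.comp (map_continuous η)
  have hη1 : ∀ b : ↥(normOneIdeles K), ‖((η (b : ideleGroup K) : ℂˣ) : ℂ)‖ ≤ 1 := fun b => (hηu _).le
  have hη1e : ∀ x : ideleGroup K, ‖((η x : ℂˣ) : ℂ)‖ₑ ≤ 1 := fun x => by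
    rw [enorm_eq_nnnorm, ← ENNReal.coe_one, ENNReal.coe_le_coe, ← NNReal.coe_le_coe, coe_nnnorm]
    exact (hηu x).le
  ----------------------------------------------------------------
  -- the twisted test function
  ----------------------------------------------------------------
  set eav : (AdelicGroupData.gl n K).Adelic → ℂ := fun y =>
    ∫ b, W (sc (b : ideleGroup K) * y) * ((η (b : ideleGroup K) : ℂˣ) : ℂ) * (wt β₁ b : ℂ) ∂β with heav
  set f : (AdelicGroupData.gl n K).Adelic → ℂ := fun y => eav y⁻¹ * (wt βA y⁻¹ : ℂ) with hf
  have hwt₁ : Measurable fun b : ↥(normOneIdeles K) => (wt β₁ b : ℂ) :=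
    Complex.measurable_ofReal.comp hβ₁.measurable.ennreal_toReal
  have hwtG : Measurable fun y : (AdelicGroupData.gl n K).Adelic => (wt βA y : ℂ) :=
    Complex.measurable_ofReal.comp hβA.measurable.ennreal_toReal
  have hWb_meas : Measurable fun q : (AdelicGroupData.gl n K).Adelic × ↥(normOneIdeles K) =>
      W (sc (q.2 : ideleGroup K) * q.1) * ((η (q.2 : ideleGroup K) : ℂˣ) : ℂ) * (wt β₁ q.2 : ℂ) := by
    refine Measurable.mul (Measurable.mul (hW.comp ?_) ?_) (hwt₁.comp measurable_snd)
    · exact ((hsc_cont.comp (continuous_subtype_val.comp continuous_snd)).mul continuous_fst).measurable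
    · exact (hηc.comp (continuous_subtype_val.comp continuous_snd)).measurable
  have heav_meas : Measurable eav := (hWb_meas.stronglyMeasurable.integral_prod_right').measurable
  have hf_meas : Measurable f :=
    (heav_meas.comp continuous_inv.measurable).mul (hwtG.comp continuous_inv.measurable)
  -- domination of `f · F∘π` by the untwisted majorant test function, and its integrability
  set Wn : (AdelicGroupData.gl n K).Adelic → ℝ≥0∞ := fun y => ‖W y‖ₑ with hWn
  have hWn_meas : Measurable Wn := hW.enorm
  have hWnK : ∀ (γ : GL (Fin n) K) (y : (AdelicGroupData.gl n K).Adelic),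
      Wn ((AdelicGroupData.gl n K).toAdelic γ * y) = Wn y := fun γ y => by simp only [hWn, hWK]
  set Fn : (AdelicGroupData.gl n K).automorphicQuotient → ℝ≥0∞ := fun x => ‖F x‖ₑ with hFn
  have hFn_meas : Measurable Fn := hF.enorm
  have hFnZ : ∀ (z : ideleGroup K) (y : (AdelicGroupData.gl n K).Adelic),
      Fn ((AdelicGroupData.gl n K).toAutomorphicQuotient (sc z * y)) = Fn ((AdelicGroupData.gl n K).toAutomorphicQuotient y) := by
    intro z y
    simp only [hFn, hFZ', enorm_mul]
    have h : ‖(((η⁻¹) z : ℂˣ) : ℂ)‖ₑ = 1 := by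
      rw [enorm_eq_nnnorm, ENNReal.coe_eq_one, ← NNReal.coe_eq_one, coe_nnnorm, hξu z]
    rw [h, one_mul]
  have hfle : ∀ g : (AdelicGroupData.gl n K).Adelic,
      ‖f g * F ((AdelicGroupData.gl n K).toAutomorphicQuotient g)‖ₑ ≤
        (∫⁻ b, Wn (sc (b : ideleGroup K) * g⁻¹) * β₁ b ∂β) * βA g⁻¹ * Fn ((AdelicGroupData.gl n K).toAutomorphicQuotient g) := by
    intro g
    simp only [hf, hFn, enorm_mul]
    refine mul_le_mul' (mul_le_mul' ?_ (enorm_ofReal_wt_le βA _)) le_rfl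
    refine (enorm_integral_le_lintegral_enorm _).trans (lintegral_mono fun b => ?_)
    simp only [enorm_mul, hWn]
    calc ‖W (sc (b : ideleGroup K) * g⁻¹)‖ₑ * ‖((η (b : ideleGroup K) : ℂˣ) : ℂ)‖ₑ * ‖(wt β₁ b : ℂ)‖ₑ
        ≤ ‖W (sc (b : ideleGroup K) * g⁻¹)‖ₑ * 1 * β₁ b := by
          gcongr
          · exact hη1e _
          · exact enorm_ofReal_wt_le β₁ b
      _ = _ := by rw [mul_one]
  have hFq : Measurable fun g : (AdelicGroupData.gl n K).Adelic => F ((AdelicGroupData.gl n K).toAutomorphicQuotient g) :=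
    hF.comp (AdelicGroupData.gl n K).continuous_toAutomorphicQuotient.measurable
  have hfi : Integrable (fun g : (AdelicGroupData.gl n K).Adelic =>
      f g * F ((AdelicGroupData.gl n K).toAutomorphicQuotient g)) ν := by
    refine ⟨(hf_meas.mul hFq).aestronglyMeasurable, ?_⟩
    rw [HasFiniteIntegral]
    refine lt_of_le_of_lt (lintegral_mono hfle) ?_
    rw [lintegral_testFun_mul_eq ν β sc hsc_cont hsc_comm hβ₁.measurable hWn_meas hWnK hβA.measurable
      hβA.coveringSum_eq hFn_meas hFnZ]
    refine ENNReal.mul_lt_top hVfin (lt_of_le_of_lt (le_of_eq (lintegral_congr fun g => ?_)) hint)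
    simp only [hWn, hFn, enorm_mul]
    ring
  ----------------------------------------------------------------
  -- Step 1 and Step 2: the fibre integral of `f` and Weil's formula (Bochner)
  ----------------------------------------------------------------
  have hweil := integral_fiberIntegralE_mul_eq (AdelicGroupData.gl n K).quotientSubgroup
    (quotientSubgroupHaar n K) μ ν hf_meas hF hfi
  set k₀ : ℂ := ((κ : ℝ) : ℂ) * (((κ₁ : ℝ) : ℂ))⁻¹ with hk₀
  have hfibre : ∀ g : (AdelicGroupData.gl n K).Adelic,
      fiberIntegralE (AdelicGroupData.gl n K).quotientSubgroup (quotientSubgroupHaar n K) f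
        (QuotientGroup.mk g : (AdelicGroupData.gl n K).automorphicQuotient) =
        k₀ * EX ((AdelicGroupData.gl n K).toAutomorphicQuotient g) := by
    intro g
    rw [fiberIntegralE_mk, hEXg g]
    exact (integral_quotientSubgroup_testFunTwisted_eq νI β α sc hsc_cont hsc_comm hscK ec hec hκ₁ hsplit hfib
      hβ₁ h𝓕 hηu hη₀ hW hWK hβA g (hmaj g)).2
  have hL : ∫ x, fiberIntegralE (AdelicGroupData.gl n K).quotientSubgroup (quotientSubgroupHaar n K) f x * F x ∂μ =
      k₀ * ∫ x, EX x * F x ∂μ := by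
    rw [← integral_const_mul]
    refine integral_congr_ae (ae_of_all _ fun x => ?_)
    obtain ⟨g, rfl⟩ := QuotientGroup.mk_surjective x
    dsimp only
    rw [hfibre g, mul_assoc]
    rfl
  ----------------------------------------------------------------
  -- Step 3: the group side
  ----------------------------------------------------------------
  have hR := integral_testFunTwisted_mul_eq ν β sc hsc_cont hsc_comm hβ₁.measurable hVfin
    (η := fun b : ↥(normOneIdeles K) => ((η (b : ideleGroup K) : ℂˣ) : ℂ))
    (hηc.comp continuous_subtype_val).measurable hη1 hW hWK hβA.measurable hβA.coveringSum_eq hF hξu hFZ' hint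
  -- `∫ η η⁻¹ β¹ dβ = V`
  have hVint : ∫ b, ((η (b : ideleGroup K) : ℂˣ) : ℂ) * (((η⁻¹) (b : ideleGroup K) : ℂˣ) : ℂ) * (wt β₁ b : ℂ) ∂β =
      ((V.toReal : ℝ) : ℂ) := by
    have h1 : ∀ b : ↥(normOneIdeles K), ((η (b : ideleGroup K) : ℂˣ) : ℂ) * (((η⁻¹) (b : ideleGroup K) : ℂˣ) : ℂ) *
        (wt β₁ b : ℂ) = ((wt β₁ b : ℝ) : ℂ) := by
      intro b
      rw [HeckeCharacter.inv_apply, Units.val_inv_eq_inv_val, mul_inv_cancel₀ (η (b : ideleGroup K)).ne_zero, one_mul]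
    simp_rw [h1]
    rw [integral_complex_ofReal]
    congr 1
    rw [hV, integral_toReal hβ₁.measurable.aemeasurable (ae_of_all _ fun b =>
      lt_of_le_of_lt (hβ₁.le_one b) ENNReal.one_lt_top)]
  ----------------------------------------------------------------
  -- Step 4: assemble
  ----------------------------------------------------------------
  change ∫ x, fiberIntegralE (AdelicGroupData.gl n K).quotientSubgroup (quotientSubgroupHaar n K) f x * F x ∂μ =
    ((c : ℝ) : ℂ) * ∫ g, f g * F ((AdelicGroupData.gl n K).toAutomorphicQuotient g) ∂ν at hweil
  rw [hL, hR, hVint] at hweil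
  have hκ0 : ((κ : ℝ) : ℂ) ≠ 0 := by exact_mod_cast (NNReal.coe_pos.2 hκ).ne'
  have hκ₁0 : ((κ₁ : ℝ) : ℂ) ≠ 0 := by exact_mod_cast (NNReal.coe_pos.2 hκ₁).ne'
  have hk₀0 : k₀ ≠ 0 := mul_ne_zero hκ0 (inv_ne_zero hκ₁0)
  have hgoal : ∫ x, EX x * F x ∂μ = k₀⁻¹ * (((c : ℝ) : ℂ) * ((((V.toReal : ℝ) : ℂ)) *
      ∫ g, W g * (wt βA g : ℂ) * F ((AdelicGroupData.gl n K).toAutomorphicQuotient g⁻¹) ∂ν)) := by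
    rw [← hweil, ← mul_assoc, inv_mul_cancel₀ hk₀0, one_mul]
  rw [hgoal, hk₀]
  push_cast
  field_simp

end Unfolding

end Literature.NumberTheory.Automorphic
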